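/-
Copyright (c) 2026 the pub-hodgecm-mathlib formalisation cell (harness21).  Prover seat hodgecm-mathlib-F0P3b-p01 (g25); E1 keeper ∕ dealer F0P3a-p03 (g30) «= β ⊇ α, GO
sigsheet-first» 2026-09-03T02:54:45Z (E1 BRICK LEDGER row 40‴β: the height oracle (H) of ★ row 40″ `F0P3cStCharTSK2PiTwoSelfExtSplitSentence` DISCHARGED at the CM datum).
-/
import Literature.RepresentationTheory.CharacterSelfExtensionSmoothAdditive          -- ★ row 40‴α (this seat): `additive_eq_zero_on_compact_of_isSmooth` (brings ★ CHAR-EXT, ★ LC-ADDITIVE, ★ SmoothRepresentation)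
import Summits.HodgeConjecture.HodgeConjecture.Theorems.F0P3cStCharTSHeightAtDatum   -- ★ row 27b H2 (this seat) p853199: `exists_height_cmBorel` (brings ★ Iwasawa, ★ `CMPrincipalSeriesSpherical`, ★ `LocalUnitaryIntegralLevel`)
import Literature.NumberTheory.Automorphic.JacquetModule                        -- ★ `Representation.normalizedJacquet`, `isSmooth_jacquetModule`
import Literature.NumberTheory.Automorphic.IrreducibleClasses                   -- ★ `Representation.IsSmooth.twist`
import Literature.NumberTheory.Automorphic.CMTorusRegularAEPrelims              -- ★ `UnitaryGroup.isClosed_torusU_of_t1Space`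
import Literature.NumberTheory.Automorphic.UnitaryGroupBorelInduction           -- ★ `cmBorelTriple`, `cmLocalForm_eq_over`
import HarnessLib

/-!
# The HEIGHT ORACLE at the CM datum: every additive character OCCURRING in `r_B τ` (τ smooth) has a height on `U(Φ_N)(L⁺_v)` — (H) of row 40″ becomes a theorem

Cell `pub/hodgecm-mathlib`, crux H413 = `stmt-HodgeConjecture-24833` (`--supports` lane, helper, THEOREMS ONLY: no definition ∕ instance ∕ notation ∕ named fact ∕ `sorry`).
Namespace `Summit.HodgeConjecture.HodgeConjecture.Cruxes.H413.F0P3cStCharTSHeightOracleAtDatum`.  E1 BRICK LEDGER (F0P3a-p03 (g30)) row 40‴β.  Seat F0P3b-p01 (g25).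

THE MATHEMATICS.  `G = U(Φ_N)(L⁺_v)`, `t := cmBorelTriple L N v` (`B = TN`), `K_v = cmLocalIntegralLevel` (compact open ★), `τ` a SMOOTH representation of `G` on `X`.  (1) `r_B τ = normalizedJacquet`
is SMOOTH as a `T`-representation: the Jacquet module is smooth (★ `isSmooth_jacquetModule`) and the normalising twist `δ_B^{-1/2}|_T` has OPEN kernel — it is `1` on the open subgroup
`{s ∈ T : s ∈ K_v}` (★ `rootDeltaChar_borel_eq_one_of_mem_isCompact`; ★ `IsSmooth.twist`).  (2) `{s ∈ T : s ∈ K_v}` is a COMPACT subgroup of `T` (`T` closed ★ `isClosed_torusU_of_t1Space`,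
`K_v` compact).  (3) Hence an additive character `λ` OCCURRING in `r_B τ` (★ CHAR-EXT relation `r_B τ (m) u₀ − χ m u₀ = (χ m · λ m) e`) kills `T ∩ K_v` (★ row 40‴α
`additive_eq_zero_on_compact_of_isSmooth`), and ★ H2 `exists_height_cmBorel` hands its HEIGHT `Λ` (`Λ(b g) = λ(proj b) + Λ g`, right-`K_v`-invariant, `Λ|_{K_v} = 0`, locally constant).
* §1 `isOpen_ker_rootDeltaChar_inv_torus_cmBorel`, **`isSmooth_normalizedJacquet_cmBorel`**, `isCompact_torus_inf_level_cmBorel`.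
* §2 **`additive_eq_zero_on_level_of_occurring`** (occurring `λ` kills `T ∩ K_v`), **`exists_height_of_occurring`** = row 40″'s (H) at the datum (its letters verbatim, `KΛ := K_v`).
[cite: BernsteinZelevinsky1977, §1.8; §2.3] [cite: Casselman1995, §3.1] [cite: Rogawski1990, §1.10 p. 9; §4.5 p. 45; §12.1 p. 171] [cite: Brown1982, Ch. III §1 Exercise 2 p. 60]
HONEST LABEL: count-neutral; after this file the SENTENCE's hypothesis list at the datum is {(d1), (b) «`r_B τ` self-extension of the `χ_ξ`-line», (ND∀≠0)} — all PRINT, NAMED; h413 OPEN;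
HC_CM is proved only modulo the 7 printed citations (2 remaining named inputs hLiu418 = stmt-HodgeConjecture-24832, h413 = stmt-HodgeConjecture-24833) until rung 0 closes.

## References
* [BernsteinZelevinsky1977] I. N. Bernstein, A. V. Zelevinsky, *Induced representations of reductive p-adic groups I*, Ann. Sci. ÉNS 10 (1977), §1.8, §2.3.
* [Casselman1995] W. Casselman, *Introduction to the theory of admissible representations of p-adic reductive groups* (1995), §3.1.
* [Rogawski1990] J. D. Rogawski, *Automorphic Representations of Unitary Groups in Three Variables*, Ann. of Math. Stud. 123 (1990), §1.10 p. 9, §4.5 p. 45, §12.1 p. 171.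
* [Brown1982] K. S. Brown, *Cohomology of Groups*, GTM 87 (1982), Ch. III §1 Exercise 2 p. 60.
-/

set_option autoImplicit false

set_option linter.dupNamespace false

noncomputable section

open NumberField IsDedekindDomain

namespace Summit.HodgeConjecture.HodgeConjecture.Cruxes.H413.F0P3cStCharTSHeightOracleAtDatum

open Literature.NumberTheory.Automorphic Literature.NumberTheory.Automorphic.UnitaryGroup Representation Literature.RepresentationTheory

variable (L : Type) [Field L] [NumberField L] [IsCMField L] (N : ℕ) (v : HeightOneSpectrum (𝓞 ↥(maximalRealSubfield L)))
  [LocallyCompactSpace ↥(borelU (conjLocal L (IsCMField.complexConj L) v) (cmLocalForm L N v))]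

/-! ## §1 Smoothness of `r_B τ` on `T(L⁺_v)` and compactness of `T ∩ K_v` -/

/-- **The normalising twist `δ_B^{-1/2}|_T` has OPEN kernel**: it is `1` on the open subgroup `{s ∈ T : s ∈ K_v}` (★ `rootDeltaChar_borel_eq_one_of_mem_isCompact`, `K_v` compact open).
[cite: Rogawski1990, §12.1 p. 171; §4.5 p. 45] [cite: Casselman1995, §3.1] -/
theorem isOpen_ker_rootDeltaChar_inv_torus_cmBorel :
    IsOpen ((((rootDeltaChar (cmBorelTriple L N v).P)⁻¹.comp (Subgroup.inclusion (cmBorelTriple L N v).M_le)).ker :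
      Set ↥(cmBorelTriple L N v).M)) := by
  have hK := isCompact_isOpen_cmLocalIntegralLevel L N (Matrix.of fun i j : Fin N => if i.val + j.val + 1 = N then (1 : L) else 0) v
  refine Subgroup.isOpen_mono (H₁ := (cmLocalIntegralLevel L N (Matrix.of fun i j : Fin N => if i.val + j.val + 1 = N then (1 : L) else 0) v).comap
    (cmBorelTriple L N v).M.subtype) (fun s hs => ?_) (hK.2.preimage continuous_subtype_val)
  rw [Subgroup.mem_comap, Subgroup.coe_subtype] at hs
  rw [MonoidHom.mem_ker, MonoidHom.comp_apply, MonoidHom.inv_apply, inv_eq_one]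
  exact rootDeltaChar_borel_eq_one_of_mem_isCompact (conjLocal L (IsCMField.complexConj L) v) (cmLocalForm L N v) (cmLocalForm_eq_over L N v) hK.1
    (Subgroup.inclusion (cmBorelTriple L N v).M_le s) hs

/-- **`r_B τ` IS SMOOTH ON `T(L⁺_v)`** for `τ` smooth: ★ `isSmooth_jacquetModule` + ★ `IsSmooth.twist` (open kernel of `δ_B^{-1/2}|_T`). [cite: BernsteinZelevinsky1977, §1.8; §2.3] [cite: Casselman1995, §3.1] -/
theorem isSmooth_normalizedJacquet_cmBorel {X : Type*} [AddCommGroup X] [Module ℂ X]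
    (τ : Representation ℂ ↥(unitaryGroupOfForm (conjLocal L (IsCMField.complexConj L) v) (cmLocalForm L N v)) X) (hτ : τ.IsSmooth) :
    (τ.normalizedJacquet (cmBorelTriple L N v)).IsSmooth := by
  have iTG : IsTopologicalGroup ↥(unitaryGroupOfForm (conjLocal L (IsCMField.complexConj L) v) (cmLocalForm L N v)) := inferInstance
  change ((τ.jacquetModule (cmBorelTriple L N v)).twist _).IsSmooth
  exact (isSmooth_jacquetModule τ (cmBorelTriple L N v) hτ).twist (isOpen_ker_rootDeltaChar_inv_torus_cmBorel L N v)

omit [LocallyCompactSpace ↥(borelU (conjLocal L (IsCMField.complexConj L) v) (cmLocalForm L N v))] in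
/-- **`T ∩ K_v` IS COMPACT** in `T(L⁺_v)`: `T` is closed in `G` (★ `isClosed_torusU_of_t1Space`) and `K_v` is compact. [cite: Rogawski1990, §1.10 p. 9; §12.1 p. 171] -/
theorem isCompact_torus_inf_level_cmBorel :
    IsCompact (((cmLocalIntegralLevel L N (Matrix.of fun i j : Fin N => if i.val + j.val + 1 = N then (1 : L) else 0) v).comap
      (cmBorelTriple L N v).M.subtype : Subgroup ↥(cmBorelTriple L N v).M) : Set ↥(cmBorelTriple L N v).M) := by
  have hK := isCompact_isOpen_cmLocalIntegralLevel L N (Matrix.of fun i j : Fin N => if i.val + j.val + 1 = N then (1 : L) else 0) v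
  have hT : IsClosed ((torusU (conjLocal L (IsCMField.complexConj L) v) (cmLocalForm L N v) :
      Set ↥(unitaryGroupOfForm (conjLocal L (IsCMField.complexConj L) v) (cmLocalForm L N v)))) := isClosed_torusU_of_t1Space _ _
  exact (hT.isClosedEmbedding_subtypeVal).isCompact_preimage hK.1

/-! ## §2 The occurring additive character kills `T ∩ K_v`; the height -/

variable {X : Type*} [AddCommGroup X] [Module ℂ X]
  (τ : Representation ℂ ↥(unitaryGroupOfForm (conjLocal L (IsCMField.complexConj L) v) (cmLocalForm L N v)) X) (hτ : τ.IsSmooth)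
  (χ : ↥(cmBorelTriple L N v).M →* ℂ) (pJ : ((cmBorelTriple L N v).restrict τ).Coinvariants →ₗ[ℂ] ℂ)
  {u₀ e : ((cmBorelTriple L N v).restrict τ).Coinvariants} (hu₀ : pJ u₀ = 1) (he : pJ e = 0) (hfree : ∀ c : ℂ, c • e = 0 → c = 0)
  (lam : ↥(cmBorelTriple L N v).M → ℂ) (hlam : ∀ m m' : ↥(cmBorelTriple L N v).M, lam (m * m') = lam m + lam m')
  (hocc : ∀ m : ↥(cmBorelTriple L N v).M, τ.normalizedJacquet (cmBorelTriple L N v) m u₀ - χ m • u₀ = (χ m * lam m) • e)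

include hτ hu₀ he hfree hlam hocc in
/-- **AN ADDITIVE CHARACTER OCCURRING IN `r_B τ` KILLS `T ∩ K_v`** (`τ` smooth): ★ row 40‴α on the smooth `T`-representation `r_B τ` (§1) and the compact subgroup `T ∩ K_v` (§1).
[cite: Brown1982, Ch. III §1 Exercise 2 p. 60] [cite: BernsteinZelevinsky1977, §2.3] [cite: Rogawski1990, §12.1 p. 171] -/
theorem additive_eq_zero_on_level_of_occurring (s : ↥(cmBorelTriple L N v).M)
    (hs : (s : ↥(unitaryGroupOfForm (conjLocal L (IsCMField.complexConj L) v) (cmLocalForm L N v))) ∈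
      cmLocalIntegralLevel L N (Matrix.of fun i j : Fin N => if i.val + j.val + 1 = N then (1 : L) else 0) v) :
    lam s = 0 :=
  additive_eq_zero_on_compact_of_isSmooth (τ.normalizedJacquet (cmBorelTriple L N v)) χ pJ hu₀ he hfree lam hocc
    (isSmooth_normalizedJacquet_cmBorel L N v τ hτ) hlam _ (isCompact_torus_inf_level_cmBorel L N v) s
    (by rw [Subgroup.mem_comap, Subgroup.coe_subtype]; exact hs)

include hτ hu₀ he hfree hlam hocc in
/-- **THE HEIGHT ORACLE AT THE CM DATUM** — row 40″'s (H) as a THEOREM: an additive character `λ` OCCURRING in `r_B τ` (`τ` smooth) has a height `Λ : G → ℂ` with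
`Λ (b g) = λ(proj b) + Λ g`, right-invariant under the compact open `K_v`, i.e. the letters `(Λ, KΛ := K_v, hKΛ, hΛK, hΛ)` of ★ J1∕J2∕D∕40″ (★ H2 `exists_height_cmBorel` fed by
`additive_eq_zero_on_level_of_occurring`). [cite: Casselman1995, §3.1] [cite: BernsteinZelevinsky1977, §2.3] [cite: Rogawski1990, §4.5 p. 45] -/
theorem exists_height_of_occurring :
    ∃ (Λ : ↥(unitaryGroupOfForm (conjLocal L (IsCMField.complexConj L) v) (cmLocalForm L N v)) → ℂ)
      (KΛ : Subgroup ↥(unitaryGroupOfForm (conjLocal L (IsCMField.complexConj L) v) (cmLocalForm L N v))),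
      IsOpen (KΛ : Set ↥(unitaryGroupOfForm (conjLocal L (IsCMField.complexConj L) v) (cmLocalForm L N v))) ∧
      (∀ (x κ : ↥(unitaryGroupOfForm (conjLocal L (IsCMField.complexConj L) v) (cmLocalForm L N v))), κ ∈ KΛ → Λ (x * κ) = Λ x) ∧
      ∀ (q : ↥(cmBorelTriple L N v).P) (g : ↥(unitaryGroupOfForm (conjLocal L (IsCMField.complexConj L) v) (cmLocalForm L N v))),
        Λ ((q : ↥(unitaryGroupOfForm (conjLocal L (IsCMField.complexConj L) v) (cmLocalForm L N v))) * g) = lam ((cmBorelTriple L N v).proj q) + Λ g := by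
  obtain ⟨Λ, hΛ, hΛK, -, -⟩ := F0P3cStCharTSHeightAtDatum.exists_height_cmBorel L N v lam hlam
    (fun s hs => additive_eq_zero_on_level_of_occurring L N v τ hτ χ pJ hu₀ he hfree lam hlam hocc s hs)
  exact ⟨Λ, cmLocalIntegralLevel L N (Matrix.of fun i j : Fin N => if i.val + j.val + 1 = N then (1 : L) else 0) v,
    (isCompact_isOpen_cmLocalIntegralLevel L N (Matrix.of fun i j : Fin N => if i.val + j.val + 1 = N then (1 : L) else 0) v).2, hΛK, hΛ⟩

end Summit.HodgeConjecture.HodgeConjecture.Cruxes.H413.F0P3cStCharTSHeightOracleAtDatum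

end
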